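import Summits.QuantumFields.GaugeBoot.Rows.KZL2HD3RedKit
import Summits.QuantumFields.GaugeBoot.Rows.KZL2HD3HCanon1
import Summits.QuantumFields.GaugeBoot.Rows.KZL2HD3HCanon2
import Summits.QuantumFields.GaugeBoot.Rows.KZL2HD3HCanon3
import Summits.QuantumFields.GaugeBoot.Rows.KZL2HD3HCanon4
import Summits.QuantumFields.GaugeBoot.Rows.KZL2HD3HCanon5
import Summits.QuantumFields.GaugeBoot.Rows.KZL2HD3HCanon6
import Summits.QuantumFields.GaugeBoot.Rows.KZL2HD3HCanon7
import Summits.QuantumFields.GaugeBoot.Rows.KZL2HD3RedCheck1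
import Summits.QuantumFields.GaugeBoot.Rows.KZL2HD3RedCheck2
import Summits.QuantumFields.GaugeBoot.Rows.KZL2HD3RedCheck3
import Summits.QuantumFields.GaugeBoot.Rows.KZL2HD3RedCheck4
import Summits.QuantumFields.GaugeBoot.Rows.KZL2HD3RedCheck5
import Summits.QuantumFields.GaugeBoot.Rows.KZL2HD3RedCheck6
import Summits.QuantumFields.GaugeBoot.Rows.KZL2HD3RedCheck7
import Summits.QuantumFields.GaugeBoot.Rows.KZL2HD3RedCheck19
import Summits.QuantumFields.GaugeBoot.Rows.KZL2HD3RedCheck8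
import Summits.QuantumFields.GaugeBoot.Rows.KZL2HD3RedCheck9
import Summits.QuantumFields.GaugeBoot.Rows.KZL2HD3RedCheck10
import Summits.QuantumFields.GaugeBoot.Rows.KZL2HD3RedCheck11
import Summits.QuantumFields.GaugeBoot.Rows.KZL2HD3RedCheck12
import Summits.QuantumFields.GaugeBoot.Rows.KZL2HD3RedCheck13
import Summits.QuantumFields.GaugeBoot.Rows.KZL2HD3RedCheck14
import Summits.QuantumFields.GaugeBoot.Rows.KZL2HD3RedCheck15
import Summits.QuantumFields.GaugeBoot.Rows.KZL2HD3RedCheck16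
import Summits.QuantumFields.GaugeBoot.Rows.KZL2HD3RedCheck20
import Summits.QuantumFields.GaugeBoot.Rows.KZL2HD3RedCheck17
import Summits.QuantumFields.GaugeBoot.Rows.KZL2HD3RedCheck18
import HarnessLib

/-!
# Gauge-boot: THE REDUCTION STEP — the 20 reduced positivity blocks of the kz-L2-H-3D problems are PSD for the torus state

Cell `pub-gaugeboot` (HOME `run/shared/lean/pub/pub-gaugeboot/`), seat lean1 (torus layer for rows C1–C2 (and C41–C50) = the certified
kz-L2-H-3D windows: label set, raw blocks, class/witness tables, the reduction identity, per-β bindings).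

HONEST FRAMING (page 1 of every file of this cell): certified bounds on lattice expectations at STATED coupling,
gauge group, dimension and torus size; NOT a mass gap, NOT a continuum limit, NOT a string tension, NOT large `N`.
The venture is explicitly NOT Yang–Mills-summit-bearing (barriers `FixedCouplingUltralocality`,
`PerturbativeInvisibility`).

`Certificates.KZL2HD3.redBlock k (y β L)` (lean3's interface, `Certificates/KZL2HD3Tab`: block `k` of the problem files, entries
`Σ c·y_v`, evaluated on the torus expectations `y β L v = ⟨W_0(label v)⟩` of `KZL2HD3Labels`) is positive semidefinite for every
`k < 20`, EVERY torus `(ℤ/L)^3` and EVERY real `β` (Class A: Hermitian blocks only):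
`redBlock_posSemidef`.  Proof = the kernel-checked identities `KZL2HD3RedCheck…` (lean3's entries = `Y_kᵀ·cls·Y_k` as integer
forms, radix check `RedEnc.eval_eq_of_encCheck`) + `GLYZc2D3.SVec.eval_expand` / `eval_eq_sum_fin` giving
`redBlock k y = Y_kᴴ · rawBlock · Y_k` as real matrices + Mathlib's congruence `Matrix.PosSemidef.conjTranspose_mul_mul_same`
applied to `KZL2HD3Canon.rawBlockH_posSemidef`.  With lean2's equality rows and lean3's certificate halves over
`Certificates.KZL2HD3.redBlock` this closes rows C1–C2 (and C41–C50) end to end (per-β `KZL2HD3BindB<β>`).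
-/

noncomputable section

open Literature.MathematicalPhysics.QuantumFieldTheory
open Matrix
open Summit.QuantumFields.GaugeBoot.GLYZc2D3 (SVec)

namespace Summit.QuantumFields.GaugeBoot

namespace KZL2HD3

/-! ## Part 1 — the raw class table assembled: every raw entry is a labelled variable; raw blocks PSD as matrices -/

variable (β : ℝ) (L : ℕ) [NeZero L]

/-- **Every stored entry (`i ≤ j`) of the `H` table canonicalises** (assembly of the range checks). -/
theorem hcanon (i j : Fin 553) (hij : i.val ≤ j.val) : HCanonOK i j := by
  have h0 : 0 ≤ i.val := Nat.zero_le _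
  rcases Nat.lt_or_ge i.val 9 with h1 | h1
  · exact hcanon_rows_0_9 i h0 h1 j hij
  rcases Nat.lt_or_ge i.val 18 with h2 | h2
  · exact hcanon_rows_9_18 i h1 h2 j hij
  rcases Nat.lt_or_ge i.val 27 with h3 | h3
  · exact hcanon_rows_18_27 i h2 h3 j hij
  rcases Nat.lt_or_ge i.val 36 with h4 | h4
  · exact hcanon_rows_27_36 i h3 h4 j hij
  rcases Nat.lt_or_ge i.val 45 with h5 | h5
  · exact hcanon_rows_36_45 i h4 h5 j hij
  rcases Nat.lt_or_ge i.val 54 with h6 | h6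
  · exact hcanon_rows_45_54 i h5 h6 j hij
  rcases Nat.lt_or_ge i.val 64 with h7 | h7
  · exact hcanon_rows_54_64 i h6 h7 j hij
  rcases Nat.lt_or_ge i.val 74 with h8 | h8
  · exact hcanon_rows_64_74 i h7 h8 j hij
  rcases Nat.lt_or_ge i.val 84 with h9 | h9
  · exact hcanon_rows_74_84 i h8 h9 j hij
  rcases Nat.lt_or_ge i.val 94 with h10 | h10
  · exact hcanon_rows_84_94 i h9 h10 j hij
  rcases Nat.lt_or_ge i.val 104 with h11 | h11
  · exact hcanon_rows_94_104 i h10 h11 j hij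
  rcases Nat.lt_or_ge i.val 115 with h12 | h12
  · exact hcanon_rows_104_115 i h11 h12 j hij
  rcases Nat.lt_or_ge i.val 126 with h13 | h13
  · exact hcanon_rows_115_126 i h12 h13 j hij
  rcases Nat.lt_or_ge i.val 137 with h14 | h14
  · exact hcanon_rows_126_137 i h13 h14 j hij
  rcases Nat.lt_or_ge i.val 148 with h15 | h15
  · exact hcanon_rows_137_148 i h14 h15 j hij
  rcases Nat.lt_or_ge i.val 160 with h16 | h16
  · exact hcanon_rows_148_160 i h15 h16 j hij
  rcases Nat.lt_or_ge i.val 172 with h17 | h17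
  · exact hcanon_rows_160_172 i h16 h17 j hij
  rcases Nat.lt_or_ge i.val 184 with h18 | h18
  · exact hcanon_rows_172_184 i h17 h18 j hij
  rcases Nat.lt_or_ge i.val 197 with h19 | h19
  · exact hcanon_rows_184_197 i h18 h19 j hij
  rcases Nat.lt_or_ge i.val 210 with h20 | h20
  · exact hcanon_rows_197_210 i h19 h20 j hij
  rcases Nat.lt_or_ge i.val 224 with h21 | h21
  · exact hcanon_rows_210_224 i h20 h21 j hij
  rcases Nat.lt_or_ge i.val 238 with h22 | h22
  · exact hcanon_rows_224_238 i h21 h22 j hij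
  rcases Nat.lt_or_ge i.val 253 with h23 | h23
  · exact hcanon_rows_238_253 i h22 h23 j hij
  rcases Nat.lt_or_ge i.val 269 with h24 | h24
  · exact hcanon_rows_253_269 i h23 h24 j hij
  rcases Nat.lt_or_ge i.val 286 with h25 | h25
  · exact hcanon_rows_269_286 i h24 h25 j hij
  rcases Nat.lt_or_ge i.val 304 with h26 | h26
  · exact hcanon_rows_286_304 i h25 h26 j hij
  rcases Nat.lt_or_ge i.val 323 with h27 | h27
  · exact hcanon_rows_304_323 i h26 h27 j hij
  rcases Nat.lt_or_ge i.val 344 with h28 | h28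
  · exact hcanon_rows_323_344 i h27 h28 j hij
  rcases Nat.lt_or_ge i.val 367 with h29 | h29
  · exact hcanon_rows_344_367 i h28 h29 j hij
  rcases Nat.lt_or_ge i.val 393 with h30 | h30
  · exact hcanon_rows_367_393 i h29 h30 j hij
  rcases Nat.lt_or_ge i.val 425 with h31 | h31
  · exact hcanon_rows_393_425 i h30 h31 j hij
  rcases Nat.lt_or_ge i.val 467 with h32 | h32
  · exact hcanon_rows_425_467 i h31 h32 j hij
  exact hcanon_rows_467_553 i h32 i.isLt j hij


/-- **`H` entries are problem variables**: `⟨W_0(rawH a b)⟩ = y (hcls a b)` (every torus, every real `β`). -/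
theorem H_entry (a b : Fin 553) : Rung0D3.W β L (rawH a b) = y β L (hcls a b) := by
  rcases Nat.lt_or_ge b.val a.val with hab | hab
  · rw [W_rawH_symm β L b a, hcls_comm, y, ← hcanon b a hab.le, W_canonW β L _ _ (disp_rawH b a)]
  · rw [y, ← hcanon a b hab, W_canonW β L _ _ (disp_rawH a b)]

/-- **The raw `H` block in the problem variables is PSD** (every torus, every real `β`). -/
theorem H_nonneg_label (c : Fin 553 → ℝ) : 0 ≤ ∑ a, ∑ b, c a * c b * y β L (hcls a b) := by
  have h := H_nonneg β L c
  simp only [H_entry] at h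
  exact h

/-- The raw `H` block as a matrix of variables. -/
def rawBlockH : Matrix (Fin 553) (Fin 553) ℝ := Matrix.of fun a b => y β L (hcls a b)

/-- **The raw `H` block (in the variables, on the torus state) is positive semidefinite** (every torus, every real `β`). -/
theorem rawBlockH_posSemidef : (rawBlockH β L).PosSemidef :=
  posSemidef_of_table (y β L) _ hcls_comm (H_nonneg_label β L)

/-! ## Part 2 — assembly of the reduction identity for the blocks split across `RedCheck` parts -/

/-- The raw-line indices of the columns of `Y_4` (kz-L2-H-3D) are `< 553`. -/
theorem ycol_lt_4 : ∀ i < 17, ∀ p ∈ KZL2HD3.ycol 4 i, p.1 < 553 := by decide +kernel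

/-- **Reduction identity, block 4** of the kz-L2-H-3D problems (`H/irrep8(d2,c+)`, 17 × 17; 544896 expansion terms on
`i ≤ j`): lean3's entries are `Y_4ᵀ·cls·Y_4` entry by entry (radix check). -/
theorem red_ok_4 (i j : Fin 17) (hij : i.val ≤ j.val) :
    RedEnc.encCheck 20 1203 (KZL2HD3.ycol 4 i) (KZL2HD3.ycol 4 j) (fun a b => (KZL2HD3.hcls a b).val) (Certificates.KZL2HD3.ent 4 i j) = true := by
  have hi0 : 0 ≤ i.val := Nat.zero_le _
  have hj0 : 0 ≤ j.val := Nat.zero_le _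
  have him : i.val < 17 := i.isLt
  have hjm : j.val < 17 := j.isLt
  rcases Nat.lt_or_ge i.val 1 with hi1 | hi1
  · exact red_ok_4_0 i j hi0 hi1 hj0 hjm hij
  rcases Nat.lt_or_ge i.val 2 with hi2 | hi2
  · rcases Nat.lt_or_ge j.val 15 with hj1_1 | hj1_1
    · exact red_ok_4_1 i j hi1 hi2 (le_trans hi1 hij) hj1_1 hij
    exact red_ok_4_2 i j hi1 hi2 hj1_1 hjm hij
  rcases Nat.lt_or_ge i.val 3 with hi3 | hi3
  · rcases Nat.lt_or_ge j.val 15 with hj2_1 | hj2_1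
    · exact red_ok_4_3 i j hi2 hi3 (le_trans hi2 hij) hj2_1 hij
    exact red_ok_4_4 i j hi2 hi3 hj2_1 hjm hij
  rcases Nat.lt_or_ge i.val 4 with hi4 | hi4
  · exact red_ok_4_5 i j hi3 hi4 hj0 hjm hij
  rcases Nat.lt_or_ge i.val 5 with hi5 | hi5
  · exact red_ok_4_6 i j hi4 hi5 hj0 hjm hij
  rcases Nat.lt_or_ge i.val 6 with hi6 | hi6
  · rcases Nat.lt_or_ge j.val 16 with hj5_1 | hj5_1
    · exact red_ok_4_7 i j hi5 hi6 (le_trans hi5 hij) hj5_1 hij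
    exact red_ok_4_8 i j hi5 hi6 hj5_1 hjm hij
  rcases Nat.lt_or_ge i.val 7 with hi7 | hi7
  · rcases Nat.lt_or_ge j.val 13 with hj6_1 | hj6_1
    · exact red_ok_4_9 i j hi6 hi7 (le_trans hi6 hij) hj6_1 hij
    exact red_ok_4_10 i j hi6 hi7 hj6_1 hjm hij
  rcases Nat.lt_or_ge i.val 8 with hi8 | hi8
  · rcases Nat.lt_or_ge j.val 14 with hj7_1 | hj7_1
    · exact red_ok_4_11 i j hi7 hi8 (le_trans hi7 hij) hj7_1 hij
    exact red_ok_4_12 i j hi7 hi8 hj7_1 hjm hij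
  rcases Nat.lt_or_ge i.val 9 with hi9 | hi9
  · exact red_ok_4_13 i j hi8 hi9 hj0 hjm hij
  rcases Nat.lt_or_ge i.val 11 with hi10 | hi10
  · exact red_ok_4_14 i j hi9 hi10 hj0 hjm hij
  rcases Nat.lt_or_ge i.val 12 with hi11 | hi11
  · exact red_ok_4_15 i j hi10 hi11 hj0 hjm hij
  rcases Nat.lt_or_ge i.val 13 with hi12 | hi12
  · exact red_ok_4_16 i j hi11 hi12 hj0 hjm hij
  rcases Nat.lt_or_ge i.val 14 with hi13 | hi13
  · exact red_ok_4_17 i j hi12 hi13 hj0 hjm hij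
  rcases Nat.lt_or_ge i.val 15 with hi14 | hi14
  · exact red_ok_4_18 i j hi13 hi14 hj0 hjm hij
  exact red_ok_4_19 i j hi14 him hj0 hjm hij

/-- The raw-line indices of the columns of `Y_14` (kz-L2-H-3D) are `< 553`. -/
theorem ycol_lt_14 : ∀ i < 15, ∀ p ∈ KZL2HD3.ycol 14 i, p.1 < 553 := by decide +kernel

/-- **Reduction identity, block 14** of the kz-L2-H-3D problems (`H/irrep10(d2,c-)`, 15 × 15; 465920 expansion terms on
`i ≤ j`): lean3's entries are `Y_14ᵀ·cls·Y_14` entry by entry (radix check). -/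
theorem red_ok_14 (i j : Fin 15) (hij : i.val ≤ j.val) :
    RedEnc.encCheck 20 1203 (KZL2HD3.ycol 14 i) (KZL2HD3.ycol 14 j) (fun a b => (KZL2HD3.hcls a b).val) (Certificates.KZL2HD3.ent 14 i j) = true := by
  have hi0 : 0 ≤ i.val := Nat.zero_le _
  have hj0 : 0 ≤ j.val := Nat.zero_le _
  have him : i.val < 15 := i.isLt
  have hjm : j.val < 15 := j.isLt
  rcases Nat.lt_or_ge i.val 1 with hi1 | hi1
  · exact red_ok_14_0 i j hi0 hi1 hj0 hjm hij
  rcases Nat.lt_or_ge i.val 2 with hi2 | hi2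
  · rcases Nat.lt_or_ge j.val 14 with hj1_1 | hj1_1
    · exact red_ok_14_1 i j hi1 hi2 (le_trans hi1 hij) hj1_1 hij
    exact red_ok_14_2 i j hi1 hi2 hj1_1 hjm hij
  rcases Nat.lt_or_ge i.val 3 with hi3 | hi3
  · rcases Nat.lt_or_ge j.val 14 with hj2_1 | hj2_1
    · exact red_ok_14_3 i j hi2 hi3 (le_trans hi2 hij) hj2_1 hij
    exact red_ok_14_4 i j hi2 hi3 hj2_1 hjm hij
  rcases Nat.lt_or_ge i.val 4 with hi4 | hi4
  · exact red_ok_14_5 i j hi3 hi4 hj0 hjm hij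
  rcases Nat.lt_or_ge i.val 5 with hi5 | hi5
  · rcases Nat.lt_or_ge j.val 11 with hj4_1 | hj4_1
    · exact red_ok_14_6 i j hi4 hi5 (le_trans hi4 hij) hj4_1 hij
    exact red_ok_14_7 i j hi4 hi5 hj4_1 hjm hij
  rcases Nat.lt_or_ge i.val 6 with hi6 | hi6
  · rcases Nat.lt_or_ge j.val 12 with hj5_1 | hj5_1
    · exact red_ok_14_8 i j hi5 hi6 (le_trans hi5 hij) hj5_1 hij
    exact red_ok_14_9 i j hi5 hi6 hj5_1 hjm hij
  rcases Nat.lt_or_ge i.val 7 with hi7 | hi7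
  · exact red_ok_14_10 i j hi6 hi7 hj0 hjm hij
  rcases Nat.lt_or_ge i.val 9 with hi8 | hi8
  · exact red_ok_14_11 i j hi7 hi8 hj0 hjm hij
  rcases Nat.lt_or_ge i.val 10 with hi9 | hi9
  · exact red_ok_14_12 i j hi8 hi9 hj0 hjm hij
  rcases Nat.lt_or_ge i.val 11 with hi10 | hi10
  · exact red_ok_14_13 i j hi9 hi10 hj0 hjm hij
  rcases Nat.lt_or_ge i.val 12 with hi11 | hi11
  · exact red_ok_14_14 i j hi10 hi11 hj0 hjm hij
  rcases Nat.lt_or_ge i.val 13 with hi12 | hi12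
  · exact red_ok_14_15 i j hi11 hi12 hj0 hjm hij
  exact red_ok_14_16 i j hi12 him hj0 hjm hij

/-- The raw-line indices of the columns of `Y_5` (kz-L2-H-3D) are `< 553`. -/
theorem ycol_lt_5 : ∀ i < 7, ∀ p ∈ KZL2HD3.ycol 5 i, p.1 < 553 := by decide +kernel

/-- **Reduction identity, block 5** of the kz-L2-H-3D problems (`H/irrep9(d2,c+)`, 7 × 7; 223488 expansion terms on
`i ≤ j`): lean3's entries are `Y_5ᵀ·cls·Y_5` entry by entry (radix check). -/
theorem red_ok_5 (i j : Fin 7) (hij : i.val ≤ j.val) :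
    RedEnc.encCheck 20 1203 (KZL2HD3.ycol 5 i) (KZL2HD3.ycol 5 j) (fun a b => (KZL2HD3.hcls a b).val) (Certificates.KZL2HD3.ent 5 i j) = true := by
  have hi0 : 0 ≤ i.val := Nat.zero_le _
  have hj0 : 0 ≤ j.val := Nat.zero_le _
  have him : i.val < 7 := i.isLt
  have hjm : j.val < 7 := j.isLt
  rcases Nat.lt_or_ge i.val 1 with hi1 | hi1
  · exact red_ok_5_0 i j hi0 hi1 hj0 hjm hij
  rcases Nat.lt_or_ge i.val 2 with hi2 | hi2
  · rcases Nat.lt_or_ge j.val 5 with hj1_1 | hj1_1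
    · exact red_ok_5_1 i j hi1 hi2 (le_trans hi1 hij) hj1_1 hij
    exact red_ok_5_2 i j hi1 hi2 hj1_1 hjm hij
  rcases Nat.lt_or_ge i.val 3 with hi3 | hi3
  · rcases Nat.lt_or_ge j.val 6 with hj2_1 | hj2_1
    · exact red_ok_5_3 i j hi2 hi3 (le_trans hi2 hij) hj2_1 hij
    exact red_ok_5_4 i j hi2 hi3 hj2_1 hjm hij
  rcases Nat.lt_or_ge i.val 4 with hi4 | hi4
  · exact red_ok_5_5 i j hi3 hi4 hj0 hjm hij
  rcases Nat.lt_or_ge i.val 5 with hi5 | hi5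
  · exact red_ok_5_6 i j hi4 hi5 hj0 hjm hij
  exact red_ok_5_7 i j hi5 him hj0 hjm hij

/-- The raw-line indices of the columns of `Y_15` (kz-L2-H-3D) are `< 553`. -/
theorem ycol_lt_15 : ∀ i < 7, ∀ p ∈ KZL2HD3.ycol 15 i, p.1 < 553 := by decide +kernel

/-- **Reduction identity, block 15** of the kz-L2-H-3D problems (`H/irrep11(d2,c-)`, 7 × 7; 212992 expansion terms on
`i ≤ j`): lean3's entries are `Y_15ᵀ·cls·Y_15` entry by entry (radix check). -/
theorem red_ok_15 (i j : Fin 7) (hij : i.val ≤ j.val) :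
    RedEnc.encCheck 20 1203 (KZL2HD3.ycol 15 i) (KZL2HD3.ycol 15 j) (fun a b => (KZL2HD3.hcls a b).val) (Certificates.KZL2HD3.ent 15 i j) = true := by
  have hi0 : 0 ≤ i.val := Nat.zero_le _
  have hj0 : 0 ≤ j.val := Nat.zero_le _
  have him : i.val < 7 := i.isLt
  have hjm : j.val < 7 := j.isLt
  rcases Nat.lt_or_ge i.val 1 with hi1 | hi1
  · exact red_ok_15_0 i j hi0 hi1 hj0 hjm hij
  rcases Nat.lt_or_ge i.val 2 with hi2 | hi2
  · rcases Nat.lt_or_ge j.val 5 with hj1_1 | hj1_1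
    · exact red_ok_15_1 i j hi1 hi2 (le_trans hi1 hij) hj1_1 hij
    exact red_ok_15_2 i j hi1 hi2 hj1_1 hjm hij
  rcases Nat.lt_or_ge i.val 3 with hi3 | hi3
  · rcases Nat.lt_or_ge j.val 6 with hj2_1 | hj2_1
    · exact red_ok_15_3 i j hi2 hi3 (le_trans hi2 hij) hj2_1 hij
    exact red_ok_15_4 i j hi2 hi3 hj2_1 hjm hij
  rcases Nat.lt_or_ge i.val 4 with hi4 | hi4
  · exact red_ok_15_5 i j hi3 hi4 hj0 hjm hij
  rcases Nat.lt_or_ge i.val 5 with hi5 | hi5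
  · exact red_ok_15_6 i j hi4 hi5 hj0 hjm hij
  exact red_ok_15_7 i j hi5 him hj0 hjm hij

/-! ## Part 3 — the reduction step -/

/-- **THE REDUCTION STEP**: for `SU(2)` lattice gauge theory on EVERY torus `(ℤ/L)^3` and at EVERY real coupling `β`,
all 20 reduced positivity blocks of the certified kz-L2-H-3D problems (lean3's `Certificates.KZL2HD3.redBlock`), evaluated
on the torus loop expectations `y β L`, are positive semidefinite. -/
theorem redBlock_posSemidef : ∀ k : Fin 20, (Certificates.KZL2HD3.redBlock k (KZL2HD3.y β L)).PosSemidef := by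
  intro k
  fin_cases k
  exacts [entryMatrix_posSemidef (y β L) hcls (ycol 0) (fun i j => Certificates.KZL2HD3.ent 0 i j) ycol_lt_0
      (fun i j => RedEnc.sparse_ent_comm _ _ i j) hcls_comm red_ok_0 (rawBlockH_posSemidef β L),
    entryMatrix_posSemidef (y β L) hcls (ycol 1) (fun i j => Certificates.KZL2HD3.ent 1 i j) ycol_lt_1
      (fun i j => RedEnc.sparse_ent_comm _ _ i j) hcls_comm red_ok_1 (rawBlockH_posSemidef β L),
    entryMatrix_posSemidef (y β L) hcls (ycol 2) (fun i j => Certificates.KZL2HD3.ent 2 i j) ycol_lt_2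
      (fun i j => RedEnc.sparse_ent_comm _ _ i j) hcls_comm red_ok_2 (rawBlockH_posSemidef β L),
    entryMatrix_posSemidef (y β L) hcls (ycol 3) (fun i j => Certificates.KZL2HD3.ent 3 i j) ycol_lt_3
      (fun i j => RedEnc.sparse_ent_comm _ _ i j) hcls_comm red_ok_3 (rawBlockH_posSemidef β L),
    entryMatrix_posSemidef (y β L) hcls (ycol 4) (fun i j => Certificates.KZL2HD3.ent 4 i j) ycol_lt_4
      (fun i j => RedEnc.sparse_ent_comm _ _ i j) hcls_comm red_ok_4 (rawBlockH_posSemidef β L),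
    entryMatrix_posSemidef (y β L) hcls (ycol 5) (fun i j => Certificates.KZL2HD3.ent 5 i j) ycol_lt_5
      (fun i j => RedEnc.sparse_ent_comm _ _ i j) hcls_comm red_ok_5 (rawBlockH_posSemidef β L),
    entryMatrix_posSemidef (y β L) hcls (ycol 6) (fun i j => Certificates.KZL2HD3.ent 6 i j) ycol_lt_6
      (fun i j => RedEnc.sparse_ent_comm _ _ i j) hcls_comm red_ok_6 (rawBlockH_posSemidef β L),
    entryMatrix_posSemidef (y β L) hcls (ycol 7) (fun i j => Certificates.KZL2HD3.ent 7 i j) ycol_lt_7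
      (fun i j => RedEnc.sparse_ent_comm _ _ i j) hcls_comm red_ok_7 (rawBlockH_posSemidef β L),
    entryMatrix_posSemidef (y β L) hcls (ycol 8) (fun i j => Certificates.KZL2HD3.ent 8 i j) ycol_lt_8
      (fun i j => RedEnc.sparse_ent_comm _ _ i j) hcls_comm red_ok_8 (rawBlockH_posSemidef β L),
    entryMatrix_posSemidef (y β L) hcls (ycol 9) (fun i j => Certificates.KZL2HD3.ent 9 i j) ycol_lt_9
      (fun i j => RedEnc.sparse_ent_comm _ _ i j) hcls_comm red_ok_9 (rawBlockH_posSemidef β L),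
    entryMatrix_posSemidef (y β L) hcls (ycol 10) (fun i j => Certificates.KZL2HD3.ent 10 i j) ycol_lt_10
      (fun i j => RedEnc.sparse_ent_comm _ _ i j) hcls_comm red_ok_10 (rawBlockH_posSemidef β L),
    entryMatrix_posSemidef (y β L) hcls (ycol 11) (fun i j => Certificates.KZL2HD3.ent 11 i j) ycol_lt_11
      (fun i j => RedEnc.sparse_ent_comm _ _ i j) hcls_comm red_ok_11 (rawBlockH_posSemidef β L),
    entryMatrix_posSemidef (y β L) hcls (ycol 12) (fun i j => Certificates.KZL2HD3.ent 12 i j) ycol_lt_12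
      (fun i j => RedEnc.sparse_ent_comm _ _ i j) hcls_comm red_ok_12 (rawBlockH_posSemidef β L),
    entryMatrix_posSemidef (y β L) hcls (ycol 13) (fun i j => Certificates.KZL2HD3.ent 13 i j) ycol_lt_13
      (fun i j => RedEnc.sparse_ent_comm _ _ i j) hcls_comm red_ok_13 (rawBlockH_posSemidef β L),
    entryMatrix_posSemidef (y β L) hcls (ycol 14) (fun i j => Certificates.KZL2HD3.ent 14 i j) ycol_lt_14
      (fun i j => RedEnc.sparse_ent_comm _ _ i j) hcls_comm red_ok_14 (rawBlockH_posSemidef β L),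
    entryMatrix_posSemidef (y β L) hcls (ycol 15) (fun i j => Certificates.KZL2HD3.ent 15 i j) ycol_lt_15
      (fun i j => RedEnc.sparse_ent_comm _ _ i j) hcls_comm red_ok_15 (rawBlockH_posSemidef β L),
    entryMatrix_posSemidef (y β L) hcls (ycol 16) (fun i j => Certificates.KZL2HD3.ent 16 i j) ycol_lt_16
      (fun i j => RedEnc.sparse_ent_comm _ _ i j) hcls_comm red_ok_16 (rawBlockH_posSemidef β L),
    entryMatrix_posSemidef (y β L) hcls (ycol 17) (fun i j => Certificates.KZL2HD3.ent 17 i j) ycol_lt_17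
      (fun i j => RedEnc.sparse_ent_comm _ _ i j) hcls_comm red_ok_17 (rawBlockH_posSemidef β L),
    entryMatrix_posSemidef (y β L) hcls (ycol 18) (fun i j => Certificates.KZL2HD3.ent 18 i j) ycol_lt_18
      (fun i j => RedEnc.sparse_ent_comm _ _ i j) hcls_comm red_ok_18 (rawBlockH_posSemidef β L),
    entryMatrix_posSemidef (y β L) hcls (ycol 19) (fun i j => Certificates.KZL2HD3.ent 19 i j) ycol_lt_19
      (fun i j => RedEnc.sparse_ent_comm _ _ i j) hcls_comm red_ok_19 (rawBlockH_posSemidef β L)]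

end KZL2HD3

end Summit.QuantumFields.GaugeBoot

end
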